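import Summits.QuantumFields.YangMills.Theorems.LuscherReductionTwistedTraceScalingFPWeightDetSmooth
import Summits.QuantumFields.YangMills.Theorems.LuscherReductionTwistedTraceScalingInvariantFunctional
import Summits.QuantumFields.YangMills.Theorems.LuscherReductionTwistedTraceScalingSliceTaylor
import HarnessLib

/-!
# (N3) — THE GAUSSIAN DETERMINANT OF THE FADDEEV–POPOV WEIGHT IS CONSTANT TO SECOND ORDER IN THE BASE POINT: `fderiv gramDet 0 = 0`, `|gramDet p − gramDet 0| ≤ K‖p‖²`
# (lane A of S-BASE, crux `TwistedTraceScaling` stmt-QuantumFields-20203, C4 INNER; design note `pub/ym-fleet/ym-luscher-20007-p1/COARSE-DESIGN.md` §23.11 (N3))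

The mechanism of record (§23.11): `gramDet` (`= normDet(A_p∘e)²`, the squared Gaussian determinant of the Laplace evaluation (N2)) is smooth at the vacuum base point and
invariant under the global colour rotations `p ↦ Ad_g p` (`…FPWeightDetSmooth`); its derivative at the fixed point `0` is therefore an `Ad`-invariant linear functional of the
base point, and those vanish (`…InvariantFunctional`).  THIS FILE:
* ★★ `fderiv_gramDet_zero`: `fderiv ℝ gramDet 0 = 0` (chain rule at the fixed point + `eq_zero_of_adParamL_invariant'`);
* ★★★ `exists_gramDet_sq_bound`: `∃ K ε > 0, ∀ ‖p‖ < ε, |gramDet p − gramDet 0| ≤ K‖p‖²` (uniform Taylor, `…SliceTaylor`), with `0 < gramDet 0` (`gramDet_zero_pos`).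
CONSEQUENCE FOR C4 (§23.10–§23.11): at a slice point `U*` with base point `‖p*‖ ≲ β^{-σ}` the Faddeev–Popov weight is `N(U*) = (2π²)^{-n}(πs²)^{3n/2}·gramDet(0)^{-1/2}·(1 + O(β^{-2σ} +
β^{-1}log β + L⁵β^{-2σ}))` — CONSTANT on the Born–Oppenheimer core to the R25 budget (σ > 1/6): the weight `N` drops out of every Rayleigh quotient of the slice problem.
HONEST FRAMING: finite-dimensional calculus for a stub of a child of the CONDITIONAL reduction route R2b1 (the Faddeev–Popov normalisation of the tube of record); no spectral
claim; C4 OPEN; not a gap, not Clay.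
-/

set_option autoImplicit false

noncomputable section

open Filter Topology Real
open scoped BigOperators
open Literature.MathematicalPhysics.QuantumFieldTheory
open Literature.MathematicalPhysics.QuantumLattice

namespace Summit.QuantumFields.YangMills.Theorems.FemtoTransferGap.TwoLattice.ConstTube

open Summit.QuantumFields.YangMills.Theorems.FemtoTransferGap

variable (L : ℕ) [NeZero L]

/-- `gramDet` is differentiable at the vacuum base point. [folklore] -/
theorem differentiableAt_gramDet : DifferentiableAt ℝ (gramDet L) 0 :=
  (contDiffAt_gramDet L (k := 1)).differentiableAt one_ne_zero

/-- ★★ **The derivative of the Gram determinant at the vacuum base point vanishes.** [folklore] -/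
theorem fderiv_gramDet_zero : fderiv ℝ (gramDet L) 0 = 0 := by
  refine eq_zero_of_adParamL_invariant' L (fderiv ℝ (gramDet L) 0) fun g p => ?_
  -- local invariance ⇒ equal derivatives at `0`; chain rule at the fixed point `0`
  have hloc : (fun q => gramDet L (adParamL L g q)) =ᶠ[𝓝 (0 : balancedSubmodule L × (Fin 3 → Fin 3 → ℝ))] gramDet L := gramDet_ad L g
  have h1 : fderiv ℝ (fun q => gramDet L (adParamL L g q)) 0 = fderiv ℝ (gramDet L) 0 := Filter.EventuallyEq.fderiv_eq (𝕜 := ℝ) hloc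
  have h2 : fderiv ℝ (fun q => gramDet L (adParamL L g q)) 0 = (fderiv ℝ (gramDet L) 0).comp (adParamL L g) := by
    have hd : DifferentiableAt ℝ (gramDet L) (adParamL L g 0) := by rw [map_zero]; exact differentiableAt_gramDet L
    have h := (hd.hasFDerivAt.comp (0 : balancedSubmodule L × (Fin 3 → Fin 3 → ℝ)) (adParamL L g).hasFDerivAt).fderiv
    rw [map_zero] at h
    exact h
  have h3 := congrArg (fun T : (balancedSubmodule L × (Fin 3 → Fin 3 → ℝ)) →L[ℝ] ℝ => T p) (h2.symm.trans h1)
  simpa only [ContinuousLinearMap.comp_apply] using h3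

/-- ★★★ **THE GAUSSIAN DETERMINANT IS CONSTANT TO SECOND ORDER**: `∃ K ε > 0, ∀ ‖p‖ < ε, |gramDet p − gramDet 0| ≤ K‖p‖²`. [folklore] -/
theorem exists_gramDet_sq_bound : ∃ K ε : ℝ, 0 ≤ K ∧ 0 < ε ∧ ∀ p : balancedSubmodule L × (Fin 3 → Fin 3 → ℝ), ‖p‖ < ε →
    |gramDet L p - gramDet L 0| ≤ K * ‖p‖ ^ 2 := by
  -- apply the uniform Taylor lemma to `f (p, t) := gramDet p` on `P × ℝ`
  set f : (balancedSubmodule L × (Fin 3 → Fin 3 → ℝ)) × ℝ → ℝ := fun z => gramDet L z.1 with hf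
  have hfst : ContDiffAt ℝ 2 (Prod.fst : (balancedSubmodule L × (Fin 3 → Fin 3 → ℝ)) × ℝ → balancedSubmodule L × (Fin 3 → Fin 3 → ℝ)) 0 := contDiffAt_fst
  have hg : ContDiffAt ℝ 2 (gramDet L) ((Prod.fst : (balancedSubmodule L × (Fin 3 → Fin 3 → ℝ)) × ℝ → _) 0) := by
    rw [Prod.fst_zero]; exact contDiffAt_gramDet L
  have hf2 : ContDiffAt ℝ 2 f 0 := hg.comp 0 hfst
  obtain ⟨M, ε, hM, hε, h⟩ := exists_taylor_two_of_contDiffAt (f := f) hf2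
  refine ⟨M, ε, hM, hε, fun p hp => ?_⟩
  have h0 := h p (0 : ℝ) hp (by rw [norm_zero]; exact hε)
  -- the derivative of `f` at `(0, 0)` is `fderiv gramDet 0 ∘ fst = 0`
  have hder : fderiv ℝ f ((0 : balancedSubmodule L × (Fin 3 → Fin 3 → ℝ)), (0 : ℝ)) = 0 := by
    have hfst' : HasFDerivAt (Prod.fst : (balancedSubmodule L × (Fin 3 → Fin 3 → ℝ)) × ℝ → balancedSubmodule L × (Fin 3 → Fin 3 → ℝ))
        (ContinuousLinearMap.fst ℝ (balancedSubmodule L × (Fin 3 → Fin 3 → ℝ)) ℝ) ((0 : balancedSubmodule L × (Fin 3 → Fin 3 → ℝ)), (0 : ℝ)) := hasFDerivAt_fst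
    have hg' : HasFDerivAt (gramDet L) (fderiv ℝ (gramDet L) 0)
        ((Prod.fst : (balancedSubmodule L × (Fin 3 → Fin 3 → ℝ)) × ℝ → _) ((0 : balancedSubmodule L × (Fin 3 → Fin 3 → ℝ)), (0 : ℝ))) :=
      (differentiableAt_gramDet L).hasFDerivAt
    have h1 := (hg'.comp ((0 : balancedSubmodule L × (Fin 3 → Fin 3 → ℝ)), (0 : ℝ)) hfst').fderiv
    rw [fderiv_gramDet_zero, ContinuousLinearMap.zero_comp] at h1
    exact h1
  rw [hder] at h0
  rw [show ((0 : ((↥(balancedSubmodule L) × (Fin 3 → Fin 3 → ℝ)) × ℝ) →L[ℝ] ℝ) (p, 0)) = 0 from rfl, sub_zero] at h0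
  simpa [hf, Real.norm_eq_abs] using h0

/-- ★ Relative form: `|gramDet p / gramDet 0 − 1| ≤ (K / gramDet 0)·‖p‖²` near `0`. [folklore] -/
theorem exists_gramDet_ratio_bound : ∃ K ε : ℝ, 0 ≤ K ∧ 0 < ε ∧ ∀ p : balancedSubmodule L × (Fin 3 → Fin 3 → ℝ), ‖p‖ < ε →
    |gramDet L p / gramDet L 0 - 1| ≤ K * ‖p‖ ^ 2 := by
  obtain ⟨K, ε, hK, hε, h⟩ := exists_gramDet_sq_bound L
  have hD := gramDet_zero_pos L
  refine ⟨K / gramDet L 0, ε, by positivity, hε, fun p hp => ?_⟩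
  have h1 := h p hp
  rw [show gramDet L p / gramDet L 0 - 1 = (gramDet L p - gramDet L 0) / gramDet L 0 by field_simp, abs_div, abs_of_pos hD,
    div_le_iff₀ hD]
  calc |gramDet L p - gramDet L 0| ≤ K * ‖p‖ ^ 2 := h1
    _ = K / gramDet L 0 * ‖p‖ ^ 2 * gramDet L 0 := by field_simp

end Summit.QuantumFields.YangMills.Theorems.FemtoTransferGap.TwoLattice.ConstTube

end
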